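import Mathlib.MeasureTheory.Function.L2Space
import Mathlib.MeasureTheory.Function.LpOrder
import Mathlib.MeasureTheory.Integral.Prod
import Mathlib.MeasureTheory.Integral.Bochner.Basic
import Mathlib.Analysis.InnerProductSpace.Basic
import Literature.Analysis.FunctionSpaces.ContinuousKernelCompactOperator
import HarnessLib

/-!
# Integral operators of bounded continuous kernels on `L²` of a finite measure on `ℝ`

Topic `Literature/Analysis/FunctionSpaces`; theorems only (no definitions, no named facts). First
of two files on Jentzsch's theorem for positive kernels (sequel:
`PositiveKernelEigenfunction.lean`).

Let `ν` be a finite Borel measure on `ℝ` and `G : ℝ × ℝ → ℝ` a continuous bounded kernel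
(`|G| ≤ B`). The rows `G(x, ·)` are vectors `κ x ∈ L²(ν)` depending continuously on `x`
(dominated convergence), and `(S g)(x) = ⟪κ x, g⟫ = ∫ G(x, y) g(y) dν(y)` defines a bounded operator
on the real Hilbert space `L²(ν)`; it is **compact**: the operator-norm limit of its truncations
`𝟙_{[-n,n]} S`, each compact by the tree's criterion `isCompactOperator_of_ae_eq_indicator_inner`
(continuity of the feature map on the compact `[-n, n]`), with
`‖S - 𝟙_{[-n,n]} S‖ ≤ B ν(ℝ)^{1/2} ν([-n,n]ᶜ)^{1/2} → 0` (Reed–Simon I, Thm VI.12 and §VI.6: norm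
limits of finite-rank operators; the Hilbert–Schmidt theorem).

To introduce no definition, the feature map `κ` and the operator `S` are not named: they are
produced by the existence lemmas `exists_kernelVec`, `exists_weightedKernelOp`, `exists_kernelOp`
and consumed through their characterising a.e. identities `κ x = G(x, ·)`, `S g = w ⟪κ ·, g⟫`.

* `continuous_kernelVec` — `x ↦ G(x, ·) ∈ L²(ν)` is continuous;
* `exists_weightedKernelOp` / `exists_kernelOp` — the operators `g ↦ w ⟪κ ·, g⟫` (`|w| ≤ 1`);
* `norm_kernelOp_sub_truncation_le`, `isCompactOperator_kernelOp` — truncation error and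
  compactness;
* `inner_kernelOp_eq`, `integrable_kernel_mul_mul` — the quadratic form
  `⟪S g, h⟫ = ∫ (∫ G(x, y) g(y) dν(y)) h(x) dν(x)` and integrability of `G(x, y) g(y) h(x)` on
  `ν ⊗ ν`.

## References

* M. Reed, B. Simon, *Methods of Modern Mathematical Physics I* (rev. ed. 1980), Thm VI.12,
  §VI.5–VI.6; vol. IV (1978), Thm XIII.43–44. [ReedSimonIV1978]
-/

noncomputable section

open MeasureTheory Filter Set Metric Function
open scoped ENNReal NNReal Topology InnerProductSpace

namespace Literature.Analysis.FunctionSpaces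

variable {ν : Measure ℝ}

/-! ### `L²(ν)` bookkeeping -/

/-- `⟪f, g⟫ = ∫ f g dν` on real `L²(ν)`. [folklore] -/
theorem real_inner_Lp_eq_integral (f g : Lp ℝ 2 ν) : ⟪f, g⟫_ℝ = ∫ x, f x * g x ∂ν := by
  rw [L2.inner_def]
  refine integral_congr_ae (Eventually.of_forall fun x => ?_)
  simp only [RCLike.inner_apply, conj_trivial]
  ring

/-- `‖f‖² = ∫ f² dν` on real `L²(ν)`. [folklore] -/
theorem norm_Lp_sq_eq_integral (f : Lp ℝ 2 ν) : ‖f‖ ^ 2 = ∫ x, f x ^ 2 ∂ν := by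
  rw [← real_inner_self_eq_norm_sq, real_inner_Lp_eq_integral]
  exact integral_congr_ae (Eventually.of_forall fun x => by simp [sq])

/-- An `L²(ν)` class is integrable (`ν` finite). [folklore] -/
theorem integrable_coeFn_Lp_two [IsFiniteMeasure ν] (f : Lp ℝ 2 ν) : Integrable (f : ℝ → ℝ) ν :=
  (Lp.memLp f).integrable (by norm_num)

/-! ### The kernel vectors `κ x = G(x, ·) ∈ L²(ν)` -/

section KernelVec

variable [IsFiniteMeasure ν] {G : ℝ → ℝ → ℝ} {B : ℝ}

/-- A bounded continuous kernel has rows in `L²(ν)`: `G(x, ·) ∈ L²(ν)`. [folklore] -/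
theorem memLp_kernel_row (hG : Continuous (uncurry G)) (hB : ∀ x y, |G x y| ≤ B) (x : ℝ) :
    MemLp (fun y => G x y) 2 ν :=
  MemLp.of_bound (hG.uncurry_left x).aestronglyMeasurable B
    (Eventually.of_forall fun y => by rw [Real.norm_eq_abs]; exact hB x y)

/-- **Existence of the feature map**: there is `κ : ℝ → L²(ν)` with `κ x = G(x, ·)` `ν`-a.e. for
every `x` (namely the `L²` class of the row). [folklore] -/
theorem exists_kernelVec (hG : Continuous (uncurry G)) (hB : ∀ x y, |G x y| ≤ B) :
    ∃ κ : ℝ → Lp ℝ 2 ν, ∀ x, (κ x : ℝ → ℝ) =ᵐ[ν] fun y => G x y :=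
  ⟨fun x => (memLp_kernel_row hG hB x).toLp _, fun _ => MemLp.coeFn_toLp _⟩

variable {κ : ℝ → Lp ℝ 2 ν}

omit [IsFiniteMeasure ν] in
/-- `⟪κ x, g⟫ = ∫ G(x, y) g(y) dν(y)`. [folklore] -/
theorem inner_kernelVec_eq_integral (hκ : ∀ x, (κ x : ℝ → ℝ) =ᵐ[ν] fun y => G x y) (x : ℝ)
    (g : Lp ℝ 2 ν) : ⟪κ x, g⟫_ℝ = ∫ y, G x y * g y ∂ν := by
  rw [real_inner_Lp_eq_integral]
  refine integral_congr_ae ?_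
  filter_upwards [hκ x] with y hy
  rw [hy]

omit [IsFiniteMeasure ν] in
/-- `‖κ x‖² = ∫ G(x, y)² dν(y)`. [folklore] -/
theorem norm_kernelVec_sq (hκ : ∀ x, (κ x : ℝ → ℝ) =ᵐ[ν] fun y => G x y) (x : ℝ) :
    ‖κ x‖ ^ 2 = ∫ y, G x y ^ 2 ∂ν := by
  rw [norm_Lp_sq_eq_integral]
  refine integral_congr_ae ?_
  filter_upwards [hκ x] with y hy
  rw [hy]

/-- **Uniform bound on the feature map**: `‖κ x‖ ≤ B (ν ℝ)^{1/2}` when `|G| ≤ B`. [folklore] -/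
theorem norm_kernelVec_le (hκ : ∀ x, (κ x : ℝ → ℝ) =ᵐ[ν] fun y => G x y)
    (hB : ∀ x y, |G x y| ≤ B) (x : ℝ) : ‖κ x‖ ≤ B * Real.sqrt (ν.real univ) := by
  have hB0 : 0 ≤ B := (abs_nonneg _).trans (hB x x)
  have hsq : ‖κ x‖ ^ 2 ≤ (B * Real.sqrt (ν.real univ)) ^ 2 := by
    rw [norm_kernelVec_sq hκ x, mul_pow, Real.sq_sqrt measureReal_nonneg]
    calc ∫ y, G x y ^ 2 ∂ν ≤ ∫ _y, B ^ 2 ∂ν := by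
          refine integral_mono_of_nonneg (Eventually.of_forall fun y => sq_nonneg _)
            (integrable_const _) (Eventually.of_forall fun y => ?_)
          have h := hB x y
          rw [abs_le] at h
          nlinarith [h.1, h.2, sq_nonneg (G x y)]
      _ = B ^ 2 * ν.real univ := by rw [integral_const, smul_eq_mul, mul_comm]
  exact (pow_le_pow_iff_left₀ (norm_nonneg _) (by positivity) two_ne_zero).1 hsq

omit [IsFiniteMeasure ν] in
/-- `‖κ x - κ x₀‖² = ∫ (G(x, y) - G(x₀, y))² dν(y)`. [folklore] -/
theorem norm_kernelVec_sub_sq (hκ : ∀ x, (κ x : ℝ → ℝ) =ᵐ[ν] fun y => G x y) (x x₀ : ℝ) :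
    ‖κ x - κ x₀‖ ^ 2 = ∫ y, (G x y - G x₀ y) ^ 2 ∂ν := by
  rw [norm_Lp_sq_eq_integral]
  refine integral_congr_ae ?_
  filter_upwards [hκ x, hκ x₀, Lp.coeFn_sub (κ x) (κ x₀)] with y hy hy₀ hsub
  rw [hsub, Pi.sub_apply, hy, hy₀]

omit [IsFiniteMeasure ν] in
/-- Rows of a bounded kernel differ by at most `2B`. [folklore] -/
theorem abs_kernel_sub_le (hB : ∀ x y, |G x y| ≤ B) (x x₀ y : ℝ) : |G x y - G x₀ y| ≤ 2 * B := by
  have h1 := hB x y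
  have h2 := hB x₀ y
  calc |G x y - G x₀ y| ≤ |G x y| + |G x₀ y| := abs_sub _ _
    _ ≤ B + B := add_le_add h1 h2
    _ = 2 * B := by ring

/-- **The feature map `x ↦ G(x, ·) ∈ L²(ν)` is continuous** (dominated convergence: `G` is
continuous and bounded, `ν` is finite). [folklore] -/
theorem continuous_kernelVec (hG : Continuous (uncurry G)) (hB : ∀ x y, |G x y| ≤ B)
    (hκ : ∀ x, (κ x : ℝ → ℝ) =ᵐ[ν] fun y => G x y) : Continuous κ := by
  refine continuous_iff_continuousAt.2 fun x₀ => ?_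
  -- `F x = ∫ (G x y - G x₀ y)² dν(y)` is continuous in `x` and vanishes at `x₀`
  set F : ℝ → ℝ := fun x => ∫ y, (G x y - G x₀ y) ^ 2 ∂ν with hF
  have hFc : Continuous F := by
    refine continuous_of_dominated (bound := fun _ => (2 * B) ^ 2) (fun x => ?_) (fun x => ?_)
      (integrable_const _) (Eventually.of_forall fun y => ?_)
    · exact (((hG.uncurry_left x).sub (hG.uncurry_left x₀)).pow 2).aestronglyMeasurable
    · refine Eventually.of_forall fun y => ?_
      rw [Real.norm_eq_abs, abs_pow, sq_abs]
      have h := abs_kernel_sub_le hB x x₀ y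
      have h0 : 0 ≤ 2 * B := (abs_nonneg _).trans h
      rw [abs_le] at h
      nlinarith [h.1, h.2]
    · exact ((hG.uncurry_right y).sub continuous_const).pow 2
  have hF0 : F x₀ = 0 := by simp [hF]
  have hlim : Tendsto F (𝓝 x₀) (𝓝 0) := by simpa [hF0] using hFc.tendsto x₀
  rw [ContinuousAt, tendsto_iff_norm_sub_tendsto_zero]
  have hsqrt : Tendsto (fun x => Real.sqrt (F x)) (𝓝 x₀) (𝓝 0) := by
    have h := (Real.continuous_sqrt.tendsto 0).comp hlim
    rwa [Real.sqrt_zero] at h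
  refine hsqrt.congr fun x => ?_
  simp only [hF]
  rw [← norm_kernelVec_sub_sq hκ x x₀, Real.sqrt_sq (norm_nonneg _)]

/-- `x ↦ ⟪κ x, g⟫` is continuous, hence measurable. [folklore] -/
theorem continuous_inner_kernelVec (hG : Continuous (uncurry G)) (hB : ∀ x y, |G x y| ≤ B)
    (hκ : ∀ x, (κ x : ℝ → ℝ) =ᵐ[ν] fun y => G x y) (g : Lp ℝ 2 ν) :
    Continuous fun x => ⟪κ x, g⟫_ℝ :=
  (continuous_kernelVec hG hB hκ).inner continuous_const

/-- `|⟪κ x, g⟫| ≤ B (ν ℝ)^{1/2} ‖g‖`. [folklore] -/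
theorem abs_inner_kernelVec_le (hκ : ∀ x, (κ x : ℝ → ℝ) =ᵐ[ν] fun y => G x y)
    (hB : ∀ x y, |G x y| ≤ B) (x : ℝ) (g : Lp ℝ 2 ν) :
    |⟪κ x, g⟫_ℝ| ≤ B * Real.sqrt (ν.real univ) * ‖g‖ :=
  (abs_real_inner_le_norm _ _).trans
    (mul_le_mul_of_nonneg_right (norm_kernelVec_le hκ hB x) (norm_nonneg _))

end KernelVec

/-! ### The integral operator `S g = ⟪κ ·, g⟫` and its truncations -/

section KernelOp

variable [IsFiniteMeasure ν] {G : ℝ → ℝ → ℝ} {B : ℝ} {κ : ℝ → Lp ℝ 2 ν}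

/-- **Existence of the (weighted) integral operator on `L²(ν)`**: for a measurable weight `w` with
`|w| ≤ 1` there is a bounded operator `S_w` on `L²(ν)` acting as
`(S_w g)(x) = w(x) ⟪κ x, g⟫ = w(x) ∫ G(x, y) g(y) dν(y)` a.e. (the function is bounded by
`B (ν ℝ)^{1/2} ‖g‖`, so lies in `L²` of the finite measure `ν`). `w = 1` gives the integral
operator `S` of the kernel `G`, `w = 𝟙_K` its truncations. [folklore] -/
theorem exists_weightedKernelOp (hG : Continuous (uncurry G)) (hB : ∀ x y, |G x y| ≤ B)
    (hκ : ∀ x, (κ x : ℝ → ℝ) =ᵐ[ν] fun y => G x y) {w : ℝ → ℝ} (hw : Measurable w)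
    (hw1 : ∀ x, |w x| ≤ 1) :
    ∃ S : Lp ℝ 2 ν →L[ℝ] Lp ℝ 2 ν, ∀ g : Lp ℝ 2 ν,
      (S g : ℝ → ℝ) =ᵐ[ν] fun x => w x * ⟪κ x, g⟫_ℝ := by
  set M : ℝ := B * Real.sqrt (ν.real univ) with hM
  have hM0 : 0 ≤ M := by
    have hB0 : 0 ≤ B := (abs_nonneg _).trans (hB 0 0)
    positivity
  -- the candidate function and its membership in `L²`
  have hmeas : ∀ g : Lp ℝ 2 ν, Measurable fun x => w x * ⟪κ x, g⟫_ℝ := fun g =>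
    hw.mul (continuous_inner_kernelVec hG hB hκ g).measurable
  have hbd : ∀ (g : Lp ℝ 2 ν) (x : ℝ), ‖w x * ⟪κ x, g⟫_ℝ‖ ≤ M * ‖g‖ := by
    intro g x
    rw [Real.norm_eq_abs, abs_mul]
    calc |w x| * |⟪κ x, g⟫_ℝ| ≤ 1 * (M * ‖g‖) :=
          mul_le_mul (hw1 x) (abs_inner_kernelVec_le hκ hB x g) (abs_nonneg _) zero_le_one
      _ = M * ‖g‖ := one_mul _
  have hmem : ∀ g : Lp ℝ 2 ν, MemLp (fun x => w x * ⟪κ x, g⟫_ℝ) 2 ν := fun g =>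
    MemLp.of_bound (hmeas g).aestronglyMeasurable (M * ‖g‖) (Eventually.of_forall (hbd g))
  -- linearity of the candidate
  have hadd : ∀ g g' : Lp ℝ 2 ν, (fun x => w x * ⟪κ x, g + g'⟫_ℝ) =
      (fun x => w x * ⟪κ x, g⟫_ℝ) + fun x => w x * ⟪κ x, g'⟫_ℝ := by
    intro g g'; funext x; simp only [Pi.add_apply, inner_add_right]; ring
  have hsmul : ∀ (c : ℝ) (g : Lp ℝ 2 ν), (fun x => w x * ⟪κ x, c • g⟫_ℝ) =
      c • fun x => w x * ⟪κ x, g⟫_ℝ := by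
    intro c g; funext x; simp only [Pi.smul_apply, inner_smul_right, smul_eq_mul]; ring
  set L : Lp ℝ 2 ν →ₗ[ℝ] Lp ℝ 2 ν :=
    { toFun := fun g => (hmem g).toLp _
      map_add' := fun g g' => by
        rw [← MemLp.toLp_add (hmem g) (hmem g')]
        exact MemLp.toLp_congr _ _ (Eventually.of_forall fun x => by rw [hadd])
      map_smul' := fun c g => by
        rw [RingHom.id_apply, ← MemLp.toLp_const_smul c (hmem g)]
        exact MemLp.toLp_congr _ _ (Eventually.of_forall fun x => by rw [hsmul]) } with hL
  have hLb : ∀ g, ‖L g‖ ≤ (measureUnivNNReal ν : ℝ) ^ (2 : ℝ)⁻¹ * M * ‖g‖ := by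
    intro g
    have hpt : ∀ᵐ x ∂ν, ‖((hmem g).toLp _ : Lp ℝ 2 ν) x‖ ≤ M * ‖g‖ := by
      filter_upwards [(hmem g).coeFn_toLp] with x hx
      rw [hx]; exact hbd g x
    have h := Lp.norm_le_of_ae_bound (f := (hmem g).toLp _) (by positivity) hpt
    simp only [ENNReal.toReal_ofNat] at h
    calc ‖L g‖ = ‖((hmem g).toLp _ : Lp ℝ 2 ν)‖ := rfl
      _ ≤ (measureUnivNNReal ν : ℝ) ^ (2 : ℝ)⁻¹ * (M * ‖g‖) := h
      _ = _ := by ring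
  refine ⟨L.mkContinuous _ hLb, fun g => ?_⟩
  rw [LinearMap.mkContinuous_apply]
  exact (hmem g).coeFn_toLp

/-- **Existence of the integral operator** `S` on `L²(ν)` with `(S g)(x) = ⟪κ x, g⟫ =
∫ G(x, y) g(y) dν(y)` a.e. [folklore] -/
theorem exists_kernelOp (hG : Continuous (uncurry G)) (hB : ∀ x y, |G x y| ≤ B)
    (hκ : ∀ x, (κ x : ℝ → ℝ) =ᵐ[ν] fun y => G x y) :
    ∃ S : Lp ℝ 2 ν →L[ℝ] Lp ℝ 2 ν, ∀ g : Lp ℝ 2 ν, (S g : ℝ → ℝ) =ᵐ[ν] fun x => ⟪κ x, g⟫_ℝ := by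
  obtain ⟨S, hS⟩ := exists_weightedKernelOp hG hB hκ (w := fun _ => (1 : ℝ)) measurable_const
    (fun _ => by simp)
  exact ⟨S, fun g => (hS g).trans (Eventually.of_forall fun x => one_mul _)⟩

/-- **Truncation error**: if `S g = ⟪κ ·, g⟫` and `S_K g = 𝟙_K ⟪κ ·, g⟫` a.e., then
`‖S - S_K‖ ≤ B (ν ℝ)^{1/2} (ν Kᶜ)^{1/2}`. [folklore] -/
theorem norm_kernelOp_sub_truncation_le (hB : ∀ x y, |G x y| ≤ B)
    (hκ : ∀ x, (κ x : ℝ → ℝ) =ᵐ[ν] fun y => G x y) {K : Set ℝ} (hK : MeasurableSet K)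
    {S SK : Lp ℝ 2 ν →L[ℝ] Lp ℝ 2 ν} (hS : ∀ g : Lp ℝ 2 ν, (S g : ℝ → ℝ) =ᵐ[ν] fun x => ⟪κ x, g⟫_ℝ)
    (hSK : ∀ g : Lp ℝ 2 ν, (SK g : ℝ → ℝ) =ᵐ[ν] fun x => K.indicator (fun x => ⟪κ x, g⟫_ℝ) x) :
    ‖S - SK‖ ≤ B * Real.sqrt (ν.real univ) * Real.sqrt (ν.real Kᶜ) := by
  set M : ℝ := B * Real.sqrt (ν.real univ) with hM
  have hB0 : 0 ≤ B := (abs_nonneg _).trans (hB 0 0)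
  have hM0 : 0 ≤ M := by positivity
  refine ContinuousLinearMap.opNorm_le_bound _ (by positivity) fun g => ?_
  rw [sub_apply]
  -- the difference acts as `𝟙_{Kᶜ} ⟪κ ·, g⟫`
  have hdiff : ((S g - SK g : Lp ℝ 2 ν) : ℝ → ℝ) =ᵐ[ν]
      fun x => Kᶜ.indicator (fun x => ⟪κ x, g⟫_ℝ) x := by
    filter_upwards [Lp.coeFn_sub (S g) (SK g), hS g, hSK g] with x hsub h1 h2
    rw [hsub, Pi.sub_apply, h1, h2]
    by_cases hx : x ∈ K
    · rw [indicator_of_mem hx, indicator_of_notMem (notMem_compl_iff.2 hx), sub_self]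
    · rw [indicator_of_notMem hx, indicator_of_mem (mem_compl hx), sub_zero]
  have hsq : ‖S g - SK g‖ ^ 2 ≤ (M * ‖g‖ * Real.sqrt (ν.real Kᶜ)) ^ 2 := by
    rw [norm_Lp_sq_eq_integral, mul_pow, Real.sq_sqrt measureReal_nonneg]
    calc ∫ x, ((S g - SK g : Lp ℝ 2 ν) : ℝ → ℝ) x ^ 2 ∂ν
        = ∫ x, (Kᶜ.indicator (fun x => ⟪κ x, g⟫_ℝ) x) ^ 2 ∂ν := by
          refine integral_congr_ae ?_
          filter_upwards [hdiff] with x hx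
          rw [hx]
      _ ≤ ∫ x, Kᶜ.indicator (fun _ => (M * ‖g‖) ^ 2) x ∂ν := by
          refine integral_mono_of_nonneg (Eventually.of_forall fun x => sq_nonneg _)
            ((integrable_const _).indicator hK.compl) (Eventually.of_forall fun x => ?_)
          dsimp only
          by_cases hx : x ∈ Kᶜ
          · rw [indicator_of_mem hx, indicator_of_mem hx]
            have h := abs_inner_kernelVec_le hκ hB x g
            rw [abs_le] at h
            have h0 : 0 ≤ M * ‖g‖ := by positivity
            nlinarith [h.1, h.2]
          · rw [indicator_of_notMem hx, indicator_of_notMem hx]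
            simp
      _ = (M * ‖g‖) ^ 2 * ν.real Kᶜ := by
          rw [integral_indicator_const _ hK.compl, smul_eq_mul, mul_comm]
  have h := (pow_le_pow_iff_left₀ (norm_nonneg _) (by positivity) two_ne_zero).1 hsq
  calc ‖S g - SK g‖ ≤ M * ‖g‖ * Real.sqrt (ν.real Kᶜ) := h
    _ = M * Real.sqrt (ν.real Kᶜ) * ‖g‖ := by ring

/-- **The integral operator of a bounded continuous kernel on `L²` of a finite measure on `ℝ` is
compact**: it is the operator-norm limit of its truncations `𝟙_{[-n,n]} S`, which are compact by
`isCompactOperator_of_ae_eq_indicator_inner` (continuity of the feature map on the compact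
`[-n, n]`), and `‖S - 𝟙_{[-n,n]} S‖ ≤ C ν([-n,n]ᶜ)^{1/2} → 0` (Reed–Simon I, Thm VI.12 and §VI.6;
the Hilbert–Schmidt theorem). [cite: ReedSimonIV1978, Thm XIII.44] -/
theorem isCompactOperator_kernelOp (hG : Continuous (uncurry G)) (hB : ∀ x y, |G x y| ≤ B)
    (hκ : ∀ x, (κ x : ℝ → ℝ) =ᵐ[ν] fun y => G x y) {S : Lp ℝ 2 ν →L[ℝ] Lp ℝ 2 ν}
    (hS : ∀ g : Lp ℝ 2 ν, (S g : ℝ → ℝ) =ᵐ[ν] fun x => ⟪κ x, g⟫_ℝ) : IsCompactOperator S := by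
  set M : ℝ := B * Real.sqrt (ν.real univ) with hM
  -- the truncations
  have key : ∀ n : ℕ, ∃ SK : Lp ℝ 2 ν →L[ℝ] Lp ℝ 2 ν, IsCompactOperator SK ∧
      ‖S - SK‖ ≤ M * Real.sqrt (ν.real (closedBall (0 : ℝ) n)ᶜ) := by
    intro n
    set K : Set ℝ := closedBall (0 : ℝ) n with hKdef
    have hKm : MeasurableSet K := measurableSet_closedBall
    obtain ⟨SK, hSK⟩ := exists_weightedKernelOp hG hB hκ (w := K.indicator fun _ => (1 : ℝ))
      (measurable_const.indicator hKm) (fun x => by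
        by_cases hx : x ∈ K
        · rw [indicator_of_mem hx, abs_one]
        · rw [indicator_of_notMem hx, abs_zero]; exact zero_le_one)
    have hSK' : ∀ g : Lp ℝ 2 ν, (SK g : ℝ → ℝ) =ᵐ[ν] fun x => K.indicator (fun x => ⟪κ x, g⟫_ℝ) x := by
      intro g
      filter_upwards [hSK g] with x hx
      rw [hx]
      by_cases h : x ∈ K
      · rw [indicator_of_mem h, indicator_of_mem h, one_mul]
      · rw [indicator_of_notMem h, indicator_of_notMem h, zero_mul]
    refine ⟨SK, ?_, norm_kernelOp_sub_truncation_le hB hκ hKm hS hSK'⟩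
    exact isCompactOperator_of_ae_eq_indicator_inner (isCompact_closedBall (0 : ℝ) n) κ
      (continuous_kernelVec hG hB hκ).continuousOn SK (fun g => hSK' g)
  choose SK hSKc hSKn using key
  -- `ν([-n,n]ᶜ) → 0`
  have hmeas : Tendsto (fun n : ℕ => ν.real (closedBall (0 : ℝ) n)ᶜ) atTop (𝓝 0) := by
    have hanti : Antitone fun n : ℕ => (closedBall (0 : ℝ) n)ᶜ := by
      intro m n hmn
      exact compl_subset_compl.2 (closedBall_subset_closedBall (by exact_mod_cast hmn))
    have hinter : (⋂ n : ℕ, (closedBall (0 : ℝ) n)ᶜ) = ∅ := by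
      refine eq_empty_of_forall_notMem fun x hx => ?_
      obtain ⟨n, hn⟩ := exists_nat_ge |x|
      have h := mem_iInter.1 hx n
      exact h (mem_closedBall.2 (by simpa using hn))
    have h := tendsto_measure_iInter_atTop (μ := ν)
      (fun n : ℕ => (measurableSet_closedBall.compl :
        MeasurableSet (closedBall (0 : ℝ) (n : ℝ))ᶜ).nullMeasurableSet) hanti
      ⟨0, measure_ne_top ν _⟩
    rw [hinter, measure_empty] at h
    have h' := (ENNReal.tendsto_toReal ENNReal.zero_ne_top).comp h
    rw [ENNReal.toReal_zero] at h'
    exact h'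
  have hbound : Tendsto (fun n : ℕ => M * Real.sqrt (ν.real (closedBall (0 : ℝ) n)ᶜ)) atTop
      (𝓝 0) := by
    have h := ((Real.continuous_sqrt.tendsto 0).comp hmeas).const_mul M
    rwa [Real.sqrt_zero, mul_zero] at h
  refine isCompactOperator_of_tendsto (l := atTop) (F := SK) ?_ (Eventually.of_forall hSKc)
  rw [tendsto_iff_norm_sub_tendsto_zero]
  refine squeeze_zero (fun n => norm_nonneg _) (fun n => ?_) hbound
  rw [norm_sub_rev]; exact hSKn n

omit [IsFiniteMeasure ν] in
/-- **The quadratic form of the integral operator**: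
`⟪S g, h⟫ = ∫ (∫ G(x, y) g(y) dν(y)) h(x) dν(x)`. [folklore] -/
theorem inner_kernelOp_eq (hκ : ∀ x, (κ x : ℝ → ℝ) =ᵐ[ν] fun y => G x y)
    {S : Lp ℝ 2 ν →L[ℝ] Lp ℝ 2 ν} (hS : ∀ g : Lp ℝ 2 ν, (S g : ℝ → ℝ) =ᵐ[ν] fun x => ⟪κ x, g⟫_ℝ)
    (g h : Lp ℝ 2 ν) : ⟪S g, h⟫_ℝ = ∫ x, (∫ y, G x y * g y ∂ν) * h x ∂ν := by
  rw [real_inner_Lp_eq_integral]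
  refine integral_congr_ae ?_
  filter_upwards [hS g] with x hx
  rw [hx, inner_kernelVec_eq_integral hκ]

/-- The double integrand `G(x, y) g(y) h(x)` is integrable for `ν ⊗ ν` (`G` bounded, `g, h ∈ L²`
of the finite measure `ν`). [folklore] -/
theorem integrable_kernel_mul_mul (hG : Continuous (uncurry G)) (hB : ∀ x y, |G x y| ≤ B)
    (g h : Lp ℝ 2 ν) :
    Integrable (uncurry fun x y => G x y * g y * h x) (ν.prod ν) := by
  have hP : Integrable (fun z : ℝ × ℝ => (h : ℝ → ℝ) z.1 * (g : ℝ → ℝ) z.2) (ν.prod ν) :=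
    (integrable_coeFn_Lp_two h).mul_prod (integrable_coeFn_Lp_two g)
  have hI := hP.bdd_mul hG.aestronglyMeasurable (c := B)
    (Eventually.of_forall fun z => by rw [Real.norm_eq_abs]; exact hB z.1 z.2)
  refine hI.congr (Eventually.of_forall fun z => ?_)
  simp only [uncurry]
  ring

end KernelOp

end Literature.Analysis.FunctionSpaces
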